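import Summits.QuantumFields.BalabanUV.T4Continuum.Support.NE3EnergyPathC2
import Literature.Analysis.Calculus.ExpDuhamel

/-!
# T⁴ programme, node NE3, route P2 «ENERGY CONVEXITY» — leaf L3 «C2» (typer row S5-Y3), companion file: the
# DICTIONARY for the right-logarithmic velocity hypothesis of `Support/NE3EnergyPathC2`, and the corollary
# «the Wilson action is C² along every bondwise-C² path `t ↦ W·exp Γ(t)`»

NE3 formalisation swarm, leaf seat `b2b-balaban-t4-ne3-formalise-leaf-03` (gen 3), row S5-Y3 of
`HOME/t4/formal/NE3/LEAVES.md` (road P2's leaf L3, skeleton `HOME/t4/skeletons/NE3-t4-ne3-p2.md` §2A), second file.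
The main file proves, for a general path with bondwise right-logarithmic velocity `Ψ t`
(`hE : HasDerivAt (s ↦ exp (Γ s b)) (exp (Γ t b)·Ψ t b) t`) and its derivative `Ψ′ t` (`hΨ`), that
`φ(t) = A_{Wn}(W·exp Γ(t))` has `φ′ = dAction W_t (Ψ t)`, `φ″ = hess W_t (Ψ t) (Ψ t) + dAction W_t (Ψ′ t)`.  THIS FILE
makes the hypotheses dischargeable and checks them ([folklore] calculus; no estimate beyond those quoted BY NAME):
* `hasDerivAt_exp_of_hasDerivAt` — **`hE` IS DISCHARGED BY DUHAMEL'S FORMULA** with the explicit velocity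
  `Ψ t b = ∫₀¹ e^{−rΓ_t(b)} Γ′_t(b) e^{rΓ_t(b)} dr` for every differentiable bond curve (tree
  `Literature.Analysis.Calculus.ExpDuhamel.hasDerivAt_exp_comp`, [Hall2015] Thm 5.4 (5.11), PROVED there; the distance
  of this velocity to the naive `Γ′_t(b)` is `≤ 15‖Γ_t(b)‖‖Γ′_t(b)‖` for `‖Γ_t(b)‖ ≤ 1` by
  `ExpDuhamel.norm_integral_conj_exp_sub_le` — the handle row S5-Y8 needs for the field `velocity`);
* `norm_rvel_sub_le` — the velocity-defect bound `‖∫₀¹ e^{−rx} h e^{rx} dr − h‖ ≤ 15‖x‖‖h‖` (`‖x‖ ≤ 1`) in this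
  package's `ℂ`-scalar form; `rvel_unique` — the right-logarithmic velocity is unique;
* `rvel_of_base` — at a base time `Γ t₀ b = 0` the velocity is `Γ′(t₀)` (so the main file's §3 there IS
  `NE3EnergyPathEnd.hasDerivAt_fineAction_path`); `rvel_of_smul` — along `Γ = c(t)·X` it is `c′(t)·X`;
* `segment_case` — SANITY ∕ NON-VACUITY: the straight segment `s ↦ V e^{sX}` (`Ψ ≡ X`, `Ψ′ ≡ 0`) satisfies `hE`∕`hΨ`
  and the general theorem returns exactly `NE3HessForm.segment_derivData`'s data;
* `exists_velocities_of_contDiff` — for bondwise C² paths BOTH velocity data exist (`exp` is real-analytic, Mathlib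
  `NormedSpace.exp_analytic`); whence **`fineAction_path_C2`**: the Wilson action of any window is C² along every
  bondwise-C² path, with the displayed second derivative — leaf L3 «REGULARITY OF `t ↦ A(γ t)`» as stated.

HONEST FRAMING.  Finite-T⁴ bookkeeping (rung (B)+1); elementary calculus; NOTHING about Bałaban's minimisers is
asserted; NE3 NOT proved («NE3-E CONDITIONAL on ⟨named structures⟩» unchanged); spine PROVED 0∕9; no conditional of
the cell (`BetaPertH`, (B), G-an2-4) used or hidden; NOT infinite volume ∕ mass gap ∕ Clay ∕ summit progress.  ABSOLUTE
RULE kept: no printed sentence is a hypothesis ([Hall2015] Thm 5.4 enters as a theorem PROVED in the tree; context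
[Balaban1985Variational] (47), (55) pp. 285–287).  PLACEMENT: `Summits/QuantumFields/BalabanUV/`; imports
`Support.NE3EnergyPathC2` and `Literature.Analysis.Calculus.ExpDuhamel` BY NAME; restates nothing, moves nothing;
0 `def`.
-/

set_option autoImplicit false

open scoped BigOperators Matrix.Norms.L2Operator
open NormedSpace Finset

namespace Summit.QuantumFields.BalabanUV.T4Continuum.NE3EnergyPathC2Velocity

open Literature.MathematicalPhysics.QuantumFieldTheory.Balaban1983to89
open B7Prop1Explicit B7Prop2Explicit MatrixLog UnitaryModel
open T4AveragingDeficitWall hiding Site Plane Plaq Bond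
open NE3HessForm (dAction hess)
open NE3EnergyPathC2

noncomputable section

variable {d : ℕ} {n : Type*} [Fintype n] [DecidableEq n]

/-! ## §6 The dictionary for the velocity hypothesis `hE` of `NE3EnergyPathC2` -/

/-- **`hE` IS DISCHARGED BY DUHAMEL'S FORMULA**: if the bond curve `γ` has derivative `γ′` at `t`, then `s ↦ e^{γ(s)}`
has right-logarithmic velocity `∫₀¹ e^{−rγ(t)} γ′ e^{rγ(t)} dr` at `t` (the tree's
`Literature.Analysis.Calculus.ExpDuhamel.hasDerivAt_exp_comp`, [Hall2015] Thm 5.4 (5.11), PROVED there; its distance to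
`γ′` is bounded by `ExpDuhamel.norm_integral_conj_exp_sub_le`). [folklore] -/
theorem hasDerivAt_exp_of_hasDerivAt {γ : ℝ → Matrix n n ℂ} {γ' : Matrix n n ℂ} {t : ℝ} (hγ : HasDerivAt γ γ' t) :
    HasDerivAt (fun s => exp (γ s))
      (exp (γ t) * ∫ r in (0 : ℝ)..1, exp (-((r : ℂ) • γ t)) * γ' * exp ((r : ℂ) • γ t)) t := by
  letI : NormedAlgebra ℚ (Matrix n n ℂ) := NormedAlgebra.restrictScalars ℚ ℂ (Matrix n n ℂ)
  have h := Literature.Analysis.Calculus.hasDerivAt_exp_comp hγ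
  simpa only [Complex.coe_smul] using h

/-- THE VELOCITY DEFECT BOUND in the tree's operator norm: `‖∫₀¹ e^{−rx} h e^{rx} dr − h‖ ≤ 15‖x‖‖h‖` for `‖x‖ ≤ 1`
(`ExpDuhamel.norm_integral_conj_exp_sub_le` BY NAME, rewritten with the `ℂ`-scalar action used in this package) — with
`x := Γ t b`, `h := Γ′ t b` this bounds the distance of the right-logarithmic velocity from the naive one, the handle
for the field `velocity` of `NE3EnergyAssembly.RouteLeaves`. [folklore] -/
theorem norm_rvel_sub_le {x : Matrix n n ℂ} (h : Matrix n n ℂ) (hx : ‖x‖ ≤ 1) :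
    ‖(∫ r in (0 : ℝ)..1, exp (-((r : ℂ) • x)) * h * exp ((r : ℂ) • x)) - h‖ ≤ 15 * ‖x‖ * ‖h‖ := by
  letI : NormedAlgebra ℚ (Matrix n n ℂ) := NormedAlgebra.restrictScalars ℚ ℂ (Matrix n n ℂ)
  have h0 := Literature.Analysis.Calculus.norm_integral_conj_exp_sub_le x h hx
  simpa only [Complex.coe_smul] using h0

/-- THE RIGHT-LOGARITHMIC VELOCITY IS UNIQUE: two matrices `Ψ₁`, `Ψ₂` satisfying `hE` at the same time coincide
(uniqueness of derivatives, then cancel the unit `e^{γ(t)}`) — so the velocity produced by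
`exists_velocities_of_contDiff` IS the Duhamel velocity of `hasDerivAt_exp_of_hasDerivAt`. [folklore] -/
theorem rvel_unique {γ : ℝ → Matrix n n ℂ} {Ψ₁ Ψ₂ : Matrix n n ℂ} {t : ℝ}
    (h₁ : HasDerivAt (fun s => exp (γ s)) (exp (γ t) * Ψ₁) t)
    (h₂ : HasDerivAt (fun s => exp (γ s)) (exp (γ t) * Ψ₂) t) : Ψ₁ = Ψ₂ := by
  have h := h₁.unique h₂
  have h' := congrArg (fun M => exp (-γ t) * M) h
  simpa only [← mul_assoc, exp_neg_mul_exp_eq_one, one_mul] using h'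

/-- At a BASE TIME (`γ t₀ = 0`) the right-logarithmic velocity is the naive one: `hE` holds with `Ψ = γ′(t₀)`
(`NE3EnergyPathEnd.hasDerivAt_exp_path`); so §3 at such a time IS `NE3EnergyPathEnd.hasDerivAt_fineAction_path`.
[folklore] -/
theorem rvel_of_base {γ : ℝ → Matrix n n ℂ} {Y : Matrix n n ℂ} {t₀ : ℝ} (h0 : γ t₀ = 0) (hγ : HasDerivAt γ Y t₀) :
    HasDerivAt (fun t => exp (γ t)) (exp (γ t₀) * Y) t₀ := by
  rw [h0, exp_zero, one_mul]
  exact NE3EnergyPathEnd.hasDerivAt_exp_path h0 hγ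

/-- Along a reparametrised one-parameter subgroup `γ(s) = c(s)·X` the right-logarithmic velocity is `c′(t)·X`.
[folklore] -/
theorem rvel_of_smul {c : ℝ → ℝ} {c' t : ℝ} (hc : HasDerivAt c c' t) (X : Matrix n n ℂ) :
    HasDerivAt (fun s => exp (((c s : ℝ) : ℂ) • X)) (exp (((c t : ℝ) : ℂ) • X) * (((c' : ℝ) : ℂ) • X)) t := by
  have h1 : HasDerivAt (fun u : ℝ => exp (u • X)) (exp (c t • X) * X) (c t) :=
    hasDerivAt_exp_smul_const (𝕂 := ℝ) X (c t)
  have h := h1.scomp t hc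
  have e : (fun s => exp (((c s : ℝ) : ℂ) • X)) = (fun u : ℝ => exp (u • X)) ∘ c := by
    funext s
    simp only [Function.comp_apply, Complex.coe_smul]
  rw [e]
  refine h.congr_deriv ?_
  rw [mul_smul_comm, Complex.coe_smul, Complex.coe_smul]

/-- SANITY ∕ NON-VACUITY: the straight segment `Γ s = s·X`, `Ψ ≡ X`, `Ψ′ ≡ 0` satisfies `hE`∕`hΨ`, and the general
theorem returns `NE3HessForm.segment_derivData`'s data: `φ′ t = dAction (V e^{tX}) X`, `φ″ t = hess (V e^{tX}) X X`.
[folklore] -/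
theorem segment_case (W : Site d → Fin d → (Matrix n n ℂ)ˣ) (X : Site d → Fin d → Matrix n n ℂ)
    (Wn : Finset (T4AveragingDeficitWall.Plaq d)) (t : ℝ) :
    HasDerivAt (fun s : ℝ => fineAction (vary W X s) Wn) (dAction (vary W X t) X Wn) t ∧
      HasDerivAt (fun s : ℝ => dAction (vary W X s) X Wn) (hess (vary W X t) X X Wn) t := by
  have hE : ∀ (t : ℝ) (y : Site d) (κ : Fin d), HasDerivAt (fun s : ℝ => exp (((s : ℝ) : ℂ) • X y κ))
      (exp (((t : ℝ) : ℂ) • X y κ) * X y κ) t := by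
    intro t y κ
    have h := rvel_of_smul (hasDerivAt_id t) (X y κ)
    simpa using h
  have hΨ : ∀ (t : ℝ) (_y : Site d) (_κ : Fin d), HasDerivAt (fun _ : ℝ => X _y _κ) (0 : Matrix n n ℂ) t :=
    fun t _ _ => hasDerivAt_const t _
  have hv : ∀ s : ℝ, vary W (fun y κ => ((s : ℝ) : ℂ) • X y κ) 1 = vary W X s := by
    intro s
    funext y κ
    simp only [vary, Complex.ofReal_one, one_smul]
  have h := hasDerivAt_two_fineAction_path W (Γ := fun s y κ => ((s : ℝ) : ℂ) • X y κ) (Ψ := fun _ => X)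
    (Ψ' := fun _ _ _ => 0) hE hΨ Wn t
  simp only [hv] at h
  refine ⟨h.1, ?_⟩
  have h2 := h.2
  rw [show dAction (vary W X t) (fun _ _ => (0 : Matrix n n ℂ)) Wn = 0 by
    simp [dAction, nReTr], add_zero] at h2
  exact h2

/-- **EXISTENCE OF BOTH VELOCITY DATA FOR A BONDWISE C² PATH**: if every bond curve `t ↦ Γ t b` is C², there are
fields `Ψ`, `Ψ′` with `hE` and `hΨ` at every time (`Ψ t b := e^{−Γ_t(b)}·(e^{Γ_·(b)})′(t)`, `Ψ′ := ∂_t Ψ`;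
`exp` is real-analytic, Mathlib `NormedSpace.exp_analytic`). [folklore] -/
theorem exists_velocities_of_contDiff {Γ : ℝ → Site d → Fin d → Matrix n n ℂ}
    (hΓ : ∀ y κ, ContDiff ℝ 2 (fun t => Γ t y κ)) :
    ∃ Ψ Ψ' : ℝ → Site d → Fin d → Matrix n n ℂ,
      (∀ t y κ, HasDerivAt (fun s => exp (Γ s y κ)) (exp (Γ t y κ) * Ψ t y κ) t) ∧
        (∀ t y κ, HasDerivAt (fun s => Ψ s y κ) (Ψ' t y κ) t) := by
  have hexp : ContDiff ℝ 2 (fun x : Matrix n n ℂ => exp x) :=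
    contDiff_iff_contDiffAt.2 fun x => (NormedSpace.exp_analytic (𝕂 := ℝ) x).contDiffAt
  have hEc : ∀ y κ, ContDiff ℝ 2 (fun t => exp (Γ t y κ)) := fun y κ => hexp.comp (hΓ y κ)
  have hEn : ∀ y κ, ContDiff ℝ 2 (fun t => exp (-Γ t y κ)) := fun y κ => hexp.comp (hΓ y κ).neg
  have two_ne : (2 : WithTop ℕ∞) ≠ 0 := by norm_num
  -- the velocity and its derivative
  refine ⟨fun t y κ => exp (-Γ t y κ) * deriv (fun s => exp (Γ s y κ)) t,
    fun t y κ => deriv (fun s => exp (-Γ s y κ) * deriv (fun s => exp (Γ s y κ)) s) t, ?_, ?_⟩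
  · intro t y κ
    have hd : HasDerivAt (fun s => exp (Γ s y κ)) (deriv (fun s => exp (Γ s y κ)) t) t :=
      ((hEc y κ).differentiable two_ne t).hasDerivAt
    refine hd.congr_deriv ?_
    rw [← mul_assoc, exp_mul_exp_neg_eq_one, one_mul]
  · intro t y κ
    have h1 : ContDiff ℝ 1 (deriv fun s => exp (Γ s y κ)) := by
      have h2 : ContDiff ℝ (1 + 1) (fun s => exp (Γ s y κ)) := by
        rw [one_add_one_eq_two]; exact hEc y κ
      exact (contDiff_succ_iff_deriv.mp h2).2.2
    have hdiff : DifferentiableAt ℝ (fun s => exp (-Γ s y κ) * deriv (fun s => exp (Γ s y κ)) s) t :=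
      (((hEn y κ).differentiable two_ne) t).mul ((h1.differentiable one_ne_zero) t)
    exact hdiff.hasDerivAt

/-- **THE WILSON ACTION IS C² ALONG EVERY BONDWISE-C² PATH**, with the displayed second derivative: for `W`, a window
`Wn` and `Γ` with every bond curve C², there are velocity fields `Ψ`, `Ψ′` (as in `exists_velocities_of_contDiff`) such
that `φ(t) = A_{Wn}(W·exp Γ(t))` satisfies, at every `t`, `HasDerivAt φ (dAction W_t (Ψ t) Wn) t` and
`HasDerivAt φ′ (hess W_t (Ψ t) (Ψ t) Wn + dAction W_t (Ψ′ t) Wn) t`. [folklore] -/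
theorem fineAction_path_C2 (W : Site d → Fin d → (Matrix n n ℂ)ˣ) {Γ : ℝ → Site d → Fin d → Matrix n n ℂ}
    (hΓ : ∀ y κ, ContDiff ℝ 2 (fun t => Γ t y κ)) (Wn : Finset (T4AveragingDeficitWall.Plaq d)) :
    ∃ Ψ Ψ' : ℝ → Site d → Fin d → Matrix n n ℂ,
      (∀ t y κ, HasDerivAt (fun s => exp (Γ s y κ)) (exp (Γ t y κ) * Ψ t y κ) t) ∧
      ∀ t : ℝ,
        HasDerivAt (fun s : ℝ => fineAction (vary W (Γ s) 1) Wn) (dAction (vary W (Γ t) 1) (Ψ t) Wn) t ∧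
          HasDerivAt (fun s : ℝ => dAction (vary W (Γ s) 1) (Ψ s) Wn)
            (hess (vary W (Γ t) 1) (Ψ t) (Ψ t) Wn + dAction (vary W (Γ t) 1) (Ψ' t) Wn) t := by
  obtain ⟨Ψ, Ψ', hE, hΨ⟩ := exists_velocities_of_contDiff hΓ
  exact ⟨Ψ, Ψ', hE, fun t => hasDerivAt_two_fineAction_path W hE hΨ Wn t⟩


/-! ## §7 (gen 4 append, sub-row S5-Y2b-abs glue) LOCAL versions on an open time interval

The analytic chart segment of leaf L2 (`Support/NE3LinearisingPath`, E3 `NE3Linearising`) is `C²` — indeed `C^∞` — only on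
an OPEN real interval `(−ρ, ρ) ⊃ [0, 1]` (its disc of holomorphy), not on all of `ℝ`; the two theorems below are the
versions of `exists_velocities_of_contDiff` ∕ `fineAction_path_C2` that such a path feeds: hypotheses `ContDiffOn ℝ 2` on an
open interval, conclusions at every time of that interval (the fields `d1`∕`d2` of `NE3EnergyAssembly.RouteLeaves` only ask
for `t ∈ [0,1]`). [folklore] -/

/-- **LOCAL VELOCITY DATA**: if every bond curve `t ↦ Γ t b` is `C²` on the OPEN interval `Ioo a c`, there are fields
`Ψ`, `Ψ′` with `hE` and `hΨ` at every time of that interval (same formulas as `exists_velocities_of_contDiff`).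
[folklore] -/
theorem exists_velocities_of_contDiffOn {Γ : ℝ → Site d → Fin d → Matrix n n ℂ} {a c : ℝ}
    (hΓ : ∀ y κ, ContDiffOn ℝ 2 (fun t => Γ t y κ) (Set.Ioo a c)) :
    ∃ Ψ Ψ' : ℝ → Site d → Fin d → Matrix n n ℂ, ∀ t ∈ Set.Ioo a c,
      (∀ y κ, HasDerivAt (fun s => exp (Γ s y κ)) (exp (Γ t y κ) * Ψ t y κ) t) ∧
        (∀ y κ, HasDerivAt (fun s => Ψ s y κ) (Ψ' t y κ) t) := by
  have hexp : ContDiff ℝ 2 (fun x : Matrix n n ℂ => exp x) :=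
    contDiff_iff_contDiffAt.2 fun x => (NormedSpace.exp_analytic (𝕂 := ℝ) x).contDiffAt
  have hEc : ∀ y κ, ContDiffOn ℝ 2 (fun t => exp (Γ t y κ)) (Set.Ioo a c) :=
    fun y κ => hexp.comp_contDiffOn (hΓ y κ)
  have hEn : ∀ y κ, ContDiffOn ℝ 2 (fun t => exp (-Γ t y κ)) (Set.Ioo a c) :=
    fun y κ => hexp.comp_contDiffOn (hΓ y κ).neg
  have two_ne : (2 : WithTop ℕ∞) ≠ 0 := by norm_num
  refine ⟨fun t y κ => exp (-Γ t y κ) * deriv (fun s => exp (Γ s y κ)) t,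
    fun t y κ => deriv (fun s => exp (-Γ s y κ) * deriv (fun s => exp (Γ s y κ)) s) t, fun t ht => ⟨?_, ?_⟩⟩
  · intro y κ
    have hnhds : Set.Ioo a c ∈ nhds t := isOpen_Ioo.mem_nhds ht
    have hd : HasDerivAt (fun s => exp (Γ s y κ)) (deriv (fun s => exp (Γ s y κ)) t) t :=
      (((hEc y κ).differentiableOn two_ne).differentiableAt hnhds).hasDerivAt
    refine hd.congr_deriv ?_
    rw [← mul_assoc, exp_mul_exp_neg_eq_one, one_mul]
  · intro y κ
    have hnhds : Set.Ioo a c ∈ nhds t := isOpen_Ioo.mem_nhds ht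
    have h1 : ContDiffOn ℝ 1 (deriv fun s => exp (Γ s y κ)) (Set.Ioo a c) := by
      have h2 : ContDiffOn ℝ (1 + 1) (fun s => exp (Γ s y κ)) (Set.Ioo a c) := by
        rw [one_add_one_eq_two]; exact hEc y κ
      exact ((contDiffOn_succ_iff_deriv_of_isOpen isOpen_Ioo).mp h2).2.2
    have hdiff : DifferentiableAt ℝ (fun s => exp (-Γ s y κ) * deriv (fun s => exp (Γ s y κ)) s) t :=
      ((((hEn y κ).differentiableOn two_ne).differentiableAt hnhds)).mul
        (((h1.differentiableOn one_ne_zero).differentiableAt hnhds))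
    exact hdiff.hasDerivAt

/-- **THE WILSON ACTION IS C² ALONG EVERY LOCALLY-C² PATH**, local form of `fineAction_path_C2`: for `Γ` with every bond
curve `C²` on the open interval `Ioo a c` there are velocity fields `Ψ`, `Ψ′` such that at every `t ∈ Ioo a c`
`HasDerivAt φ (dAction W_t (Ψ t) Wn) t` and `HasDerivAt φ′ (hess W_t (Ψ t) (Ψ t) Wn + dAction W_t (Ψ′ t) Wn) t`
(`φ t = A_{Wn}(W·exp Γ(t))`) — the fields `act`∕`d1`∕`d2` of `RouteLeaves` for `[0,1] ⊆ Ioo a c`. [folklore] -/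
theorem fineAction_path_C2_on (W : Site d → Fin d → (Matrix n n ℂ)ˣ) {Γ : ℝ → Site d → Fin d → Matrix n n ℂ}
    {a c : ℝ} (hΓ : ∀ y κ, ContDiffOn ℝ 2 (fun t => Γ t y κ) (Set.Ioo a c))
    (Wn : Finset (T4AveragingDeficitWall.Plaq d)) :
    ∃ Ψ Ψ' : ℝ → Site d → Fin d → Matrix n n ℂ, ∀ t ∈ Set.Ioo a c,
      (∀ y κ, HasDerivAt (fun s => exp (Γ s y κ)) (exp (Γ t y κ) * Ψ t y κ) t) ∧
        HasDerivAt (fun s : ℝ => fineAction (vary W (Γ s) 1) Wn) (dAction (vary W (Γ t) 1) (Ψ t) Wn) t ∧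
          HasDerivAt (fun s : ℝ => dAction (vary W (Γ s) 1) (Ψ s) Wn)
            (hess (vary W (Γ t) 1) (Ψ t) (Ψ t) Wn + dAction (vary W (Γ t) 1) (Ψ' t) Wn) t := by
  obtain ⟨Ψ, Ψ', h⟩ := exists_velocities_of_contDiffOn hΓ
  refine ⟨Ψ, Ψ', fun t ht => ⟨(h t ht).1, ?_, ?_⟩⟩
  · exact hasDerivAt_fineAction_gpath W (h t ht).1 Wn
  · exact hasDerivAt_dAction_gpath W (h t ht).1 (h t ht).2 Wn

end

end Summit.QuantumFields.BalabanUV.T4Continuum.NE3EnergyPathC2Velocity
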